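import Summits.ValiantsHypothesis.ValiantsHypothesis.Theorems.LacunarySymmetroidMatrixDescartesDoorA26WallBubblingTowers

/-!
# Wall bubbling for `DoorA26` — (W) chain piece: CALCULUS OF THE CONFLUENT FRAME (coefficient functions, their derivative towers, continuous convergence)

HONEST FRAMING.  Chain lemmas for obligation (W) `stub_weylFaces` of `Cruxes/DoorA26/Lines/wall_bubbling.lean` (stmt-ValiantsHypothesis-19979
`DoorA26`; OPEN, typed, never asserted), W2 seat val-sym-door-p1 g14.  MIDDLE of the single-cluster branch of the reduction
«`ConfluentDoor26` ⇒ `Stmt.weylFaces_generic`» (statement file `Cruxes/DoorA26/Lines/wall_bubbling_ConfluentDoor.lean` rev 3).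

THE CONFLUENT FRAME (Newton basis).  For two merging letters `e^{δ₀t}U₀ + e^{δ₅t}U₅` with `w = δ₅ − δ₀ → 0` write
`e^{δ₀t}U₀ + e^{δ₅t}U₅ = e^{δ₀t}·(U₀ + U₅) + c(t)·(w U₅)`, `c(t) = (e^{δ₅t} − e^{δ₀t})/w = dslope (y ↦ e^{yt}) δ₀ δ₅` (for `w = 0` the second
vector is `0` and `c(t) = t e^{δ₀t}`, Mathlib's `dslope … a a = deriv`).  The genuine window function of a `(2,6)` pencil is then EXACTLY a quadratic
form `Σ_pq G_pq c_p(t)c_q(t)` in the six coefficient functions `e^{δ_k t}` (`k ≤ 4`) and `dslope (y ↦ e^{yt}) δ₀ δ₅`, with `G` the polar Gram matrix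
of the frame (next file).  This file is the CALCULUS of these coefficient functions, uniform in `w` (no case distinction survives in the statements):

* `hasDerivAt_pow_mul_exp`, `hasDerivAt_dslope_pow_mul_exp`, `iteratedDeriv_dslope_exp` — the derivative tower
  `d^i/dt^i dslope (y ↦ e^{yt}) a b = dslope (y ↦ y^i e^{yt}) a b`; `contDiff_dslope_exp`;
* `exists_dslope_pow_mul_exp_eq` — mean-value form `dslope (y ↦ y^i e^{yt}) a b = (i ξ^{i−1} + t ξ^i)e^{ξt}`, `ξ` between `a` and `b`;
* `tendsto_iteratedDeriv_dslope_exp`, `tendsto_iteratedDeriv_exp` — CONTINUOUS CONVERGENCE of all `t`-derivatives as `a_k, b_k → α`, `t_k → t₀`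
  (the limit coefficient is `dslope (y ↦ e^{yt}) α α = t e^{αt}`, the confluent slot);
* `iteratedDeriv_quadForm`, `tendsto_iteratedDeriv_quadForm` — Leibniz bookkeeping: a quadratic form `Σ_pq G_pq c_p c_q` in smooth coefficient
  functions converges with all derivatives, continuously, when the matrix entries converge and each `c_p` does.

These are exactly the `hconv`/`hf` inputs of W2 #7 `no_twenty_window_of_confluentDoor` (p653192) for the confluent frame, replacing the moment /
Vandermonde level selection of the g13 plan (report §68 (g)) by an identity.  No new definitions; nothing here bears on `DoorA26`, `MatrixDescartes`
(stmt-ValiantsHypothesis-18050) or `VP ≠ VNP`.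

[folklore] Divided differences and the mean value theorem; Leibniz' rule.
-/

-- `Summit.ValiantsHypothesis.ValiantsHypothesis.…` repeats a component by the D-0017 layout
-- (single-conjunct summit), which the `dupNamespace` linter flags; the name is mandated.
set_option linter.dupNamespace false

namespace Summit.ValiantsHypothesis.ValiantsHypothesis.Theorems.LacunarySymmetroidMatrixDescartes.WallBubbling

open Finset Filter Topology
open scoped BigOperators

/-! ## 1. The kernel `y ↦ yⁿ e^{yt}` -/

/-- `n·x^{n−1}·x = n·x^n` (with the `ℕ`-subtraction convention at `n = 0`). [folklore] -/
theorem natCast_mul_pow_pred_mul (n : ℕ) (x : ℝ) : (n : ℝ) * x ^ (n - 1) * x = (n : ℝ) * x ^ n := by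
  rcases Nat.eq_zero_or_pos n with rfl | hn
  · simp
  · obtain ⟨m, rfl⟩ := Nat.exists_eq_succ_of_ne_zero (Nat.pos_iff_ne_zero.mp hn)
    rw [Nat.succ_sub_one, pow_succ]
    ring

/-- `d/dy e^{yt} = t·e^{yt}`. [folklore] -/
theorem hasDerivAt_exp_mul_const (t x : ℝ) :
    HasDerivAt (fun y : ℝ => Real.exp (y * t)) (t * Real.exp (x * t)) x := by
  have h := ((hasDerivAt_id x).mul_const t).exp
  simp only [id, one_mul] at h
  convert h using 1
  ring

/-- `d/dy (yⁿ e^{yt}) = (n y^{n−1} + t yⁿ) e^{yt}`. [folklore] -/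
theorem hasDerivAt_pow_mul_exp (n : ℕ) (t x : ℝ) :
    HasDerivAt (fun y : ℝ => y ^ n * Real.exp (y * t)) (((n : ℝ) * x ^ (n - 1) + t * x ^ n) * Real.exp (x * t)) x := by
  have h : HasDerivAt (fun y : ℝ => y ^ n * Real.exp (y * t))
      ((n : ℝ) * x ^ (n - 1) * Real.exp (x * t) + x ^ n * (t * Real.exp (x * t))) x :=
    (hasDerivAt_pow n x).mul (hasDerivAt_exp_mul_const t x)
  exact h.congr_deriv (by ring)

/-- The confluent value: `dslope (y ↦ yⁿe^{yt}) a a = (n a^{n−1} + t aⁿ) e^{at}`. [folklore] -/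
theorem dslope_pow_mul_exp_same (n : ℕ) (t a : ℝ) :
    dslope (fun y : ℝ => y ^ n * Real.exp (y * t)) a a = ((n : ℝ) * a ^ (n - 1) + t * a ^ n) * Real.exp (a * t) := by
  rw [dslope_same]
  exact (hasDerivAt_pow_mul_exp n t a).deriv

/-- The confluent slot: `dslope (y ↦ e^{yt}) a a = t·e^{at}`. [folklore] -/
theorem dslope_exp_same (t a : ℝ) : dslope (fun y : ℝ => Real.exp (y * t)) a a = t * Real.exp (a * t) := by
  rw [dslope_same]
  exact (hasDerivAt_exp_mul_const t a).deriv

/-- The divided-difference identity `(b − a)·dslope (y ↦ e^{yt}) a b = e^{bt} − e^{at}` (all `a, b`). [folklore] -/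
theorem sub_mul_dslope_exp (a b t : ℝ) :
    (b - a) * dslope (fun y : ℝ => Real.exp (y * t)) a b = Real.exp (b * t) - Real.exp (a * t) := by
  have h := sub_smul_dslope (fun y : ℝ => Real.exp (y * t)) a b
  simpa [smul_eq_mul] using h

/-- For `b ≠ a`: `dslope (y ↦ yⁿe^{yt}) a b = (bⁿe^{bt} − aⁿe^{at})/(b − a)`. [folklore] -/
theorem dslope_pow_mul_exp_of_ne (n : ℕ) (t : ℝ) {a b : ℝ} (h : b ≠ a) :
    dslope (fun y : ℝ => y ^ n * Real.exp (y * t)) a b = (b ^ n * Real.exp (b * t) - a ^ n * Real.exp (a * t)) / (b - a) := by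
  rw [dslope_of_ne _ h, slope_def_field]

/-! ## 2. The derivative tower of `t ↦ dslope (y ↦ e^{yt}) a b` -/

/-- `d/dt dslope (y ↦ yⁿe^{yt}) a b = dslope (y ↦ y^{n+1}e^{yt}) a b` (both the divided and the confluent case). [folklore] -/
theorem hasDerivAt_dslope_pow_mul_exp (a b : ℝ) (n : ℕ) (t : ℝ) :
    HasDerivAt (fun s : ℝ => dslope (fun y : ℝ => y ^ n * Real.exp (y * s)) a b)
      (dslope (fun y : ℝ => y ^ (n + 1) * Real.exp (y * t)) a b) t := by
  by_cases h : b = a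
  · subst h
    simp only [dslope_pow_mul_exp_same]
    have h1 : HasDerivAt (fun s : ℝ => ((n : ℝ) * b ^ (n - 1) + s * b ^ n)) (b ^ n) t := by
      have := ((hasDerivAt_id t).mul_const (b ^ n)).const_add ((n : ℝ) * b ^ (n - 1))
      simpa using this
    have h2 : HasDerivAt (fun s : ℝ => Real.exp (b * s)) (Real.exp (b * t) * b) t := by
      have := ((hasDerivAt_id t).const_mul b).exp
      simpa using this
    have h3 : HasDerivAt (fun s : ℝ => ((n : ℝ) * b ^ (n - 1) + s * b ^ n) * Real.exp (b * s))
        (b ^ n * Real.exp (b * t) + ((n : ℝ) * b ^ (n - 1) + t * b ^ n) * (Real.exp (b * t) * b)) t := h1.mul h2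
    refine h3.congr_deriv ?_
    have key := natCast_mul_pow_pred_mul n b
    simp only [Nat.add_sub_cancel]
    push_cast
    linear_combination Real.exp (b * t) * key
  · simp only [dslope_pow_mul_exp_of_ne _ _ h]
    have h1 : HasDerivAt (fun s : ℝ => b ^ n * Real.exp (b * s)) (b ^ n * (Real.exp (b * t) * b)) t := by
      have := (((hasDerivAt_id t).const_mul b).exp).const_mul (b ^ n)
      simpa using this
    have h2 : HasDerivAt (fun s : ℝ => a ^ n * Real.exp (a * s)) (a ^ n * (Real.exp (a * t) * a)) t := by
      have := (((hasDerivAt_id t).const_mul a).exp).const_mul (a ^ n)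
      simpa using this
    have h3 : HasDerivAt (fun s : ℝ => (b ^ n * Real.exp (b * s) - a ^ n * Real.exp (a * s)) / (b - a))
        ((b ^ n * (Real.exp (b * t) * b) - a ^ n * (Real.exp (a * t) * a)) / (b - a)) t := (h1.sub h2).div_const (b - a)
    refine h3.congr_deriv ?_
    ring

/-- The tower: `iteratedDeriv i (s ↦ dslope (y ↦ e^{ys}) a b) = s ↦ dslope (y ↦ y^i e^{ys}) a b`. [folklore] -/
theorem iteratedDeriv_dslope_exp (a b : ℝ) (i : ℕ) :
    iteratedDeriv i (fun s : ℝ => dslope (fun y : ℝ => Real.exp (y * s)) a b)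
      = fun s => dslope (fun y : ℝ => y ^ i * Real.exp (y * s)) a b := by
  have h0 : (fun s : ℝ => dslope (fun y : ℝ => Real.exp (y * s)) a b)
      = fun s => dslope (fun y : ℝ => y ^ 0 * Real.exp (y * s)) a b := by
    funext s; simp
  rw [h0]
  exact iteratedDeriv_eq_of_tower (fun i s => dslope (fun y : ℝ => y ^ i * Real.exp (y * s)) a b)
    (fun j t => hasDerivAt_dslope_pow_mul_exp a b j t) i

/-- `t ↦ dslope (y ↦ e^{yt}) a b` is smooth. [folklore] -/
theorem contDiff_dslope_exp (a b : ℝ) (n : ℕ) : ContDiff ℝ n (fun s : ℝ => dslope (fun y : ℝ => Real.exp (y * s)) a b) := by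
  by_cases h : b = a
  · subst h
    simp only [dslope_exp_same]
    exact contDiff_id.mul (Real.contDiff_exp.comp (contDiff_const.mul contDiff_id))
  · have hrepr : (fun s : ℝ => dslope (fun y : ℝ => Real.exp (y * s)) a b)
        = fun s => (Real.exp (b * s) - Real.exp (a * s)) / (b - a) := by
      funext s; rw [dslope_of_ne _ h, slope_def_field]
    rw [hrepr]
    exact ((Real.contDiff_exp.comp (contDiff_const.mul contDiff_id)).sub
      (Real.contDiff_exp.comp (contDiff_const.mul contDiff_id))).div_const _

/-- `t ↦ e^{xt}` is smooth. [folklore] -/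
theorem contDiff_exp_const_mul' (x : ℝ) (n : ℕ) : ContDiff ℝ n (fun s : ℝ => Real.exp (x * s)) :=
  Real.contDiff_exp.comp (contDiff_const.mul contDiff_id)

/-! ## 3. Mean-value form and continuous convergence -/

/-- Mean-value form of the divided difference: `dslope (y ↦ yⁿe^{yt}) a b = (n ξ^{n−1} + t ξⁿ)e^{ξt}` for some `ξ` between `a` and `b`.
[folklore] -/
theorem exists_dslope_pow_mul_exp_eq (n : ℕ) (t a b : ℝ) :
    ∃ ξ ∈ Set.uIcc a b, dslope (fun y : ℝ => y ^ n * Real.exp (y * t)) a b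
      = ((n : ℝ) * ξ ^ (n - 1) + t * ξ ^ n) * Real.exp (ξ * t) := by
  have hcont : ∀ u v : ℝ, ContinuousOn (fun y : ℝ => y ^ n * Real.exp (y * t)) (Set.Icc u v) := fun u v =>
    ((continuous_pow n).mul (Real.continuous_exp.comp (continuous_id.mul continuous_const))).continuousOn
  rcases lt_trichotomy a b with hab | hab | hab
  · obtain ⟨ξ, hξ, hslope⟩ := exists_hasDerivAt_eq_slope (fun y : ℝ => y ^ n * Real.exp (y * t))
      (fun y => ((n : ℝ) * y ^ (n - 1) + t * y ^ n) * Real.exp (y * t)) hab (hcont a b)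
      (fun y _ => hasDerivAt_pow_mul_exp n t y)
    refine ⟨ξ, Set.mem_uIcc_of_le hξ.1.le hξ.2.le, ?_⟩
    rw [dslope_pow_mul_exp_of_ne _ _ (ne_of_gt hab), ← hslope]
  · subst hab
    exact ⟨a, Set.left_mem_uIcc, dslope_pow_mul_exp_same n t a⟩
  · obtain ⟨ξ, hξ, hslope⟩ := exists_hasDerivAt_eq_slope (fun y : ℝ => y ^ n * Real.exp (y * t))
      (fun y => ((n : ℝ) * y ^ (n - 1) + t * y ^ n) * Real.exp (y * t)) hab (hcont b a)
      (fun y _ => hasDerivAt_pow_mul_exp n t y)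
    refine ⟨ξ, Set.mem_uIcc_of_ge hξ.1.le hξ.2.le, ?_⟩
    rw [dslope_pow_mul_exp_of_ne _ _ (ne_of_lt hab), hslope, div_eq_div_iff (sub_ne_zero.mpr (ne_of_lt hab)) (sub_ne_zero.mpr (ne_of_gt hab))]
    ring

/-- Continuity of the mean-value expression. [folklore] -/
theorem tendsto_pow_mul_exp_formula (n : ℕ) {ξ t : ℕ → ℝ} {α t₀ : ℝ}
    (hξ : Tendsto ξ atTop (𝓝 α)) (ht : Tendsto t atTop (𝓝 t₀)) :
    Tendsto (fun k => (((n : ℝ) * ξ k ^ (n - 1) + t k * ξ k ^ n) * Real.exp (ξ k * t k))) atTop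
      (𝓝 ((((n : ℝ) * α ^ (n - 1) + t₀ * α ^ n) * Real.exp (α * t₀)))) :=
  (((hξ.pow (n - 1)).const_mul (n : ℝ)).add (ht.mul (hξ.pow n))).mul (Real.continuous_exp.continuousAt.tendsto.comp (hξ.mul ht))

/-- **Continuous convergence of the divided differences to the confluent value**: `a_k, b_k → α`, `t_k → t₀` ⇒
`dslope (y ↦ yⁿe^{yt_k}) a_k b_k → dslope (y ↦ yⁿe^{yt₀}) α α`. [folklore] -/
theorem tendsto_dslope_pow_mul_exp (n : ℕ) {a b t : ℕ → ℝ} {α t₀ : ℝ}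
    (ha : Tendsto a atTop (𝓝 α)) (hb : Tendsto b atTop (𝓝 α)) (ht : Tendsto t atTop (𝓝 t₀)) :
    Tendsto (fun k => dslope (fun y : ℝ => y ^ n * Real.exp (y * t k)) (a k) (b k)) atTop
      (𝓝 (dslope (fun y : ℝ => y ^ n * Real.exp (y * t₀)) α α)) := by
  choose ξ hξmem hξeq using fun k => exists_dslope_pow_mul_exp_eq n (t k) (a k) (b k)
  have hξ : Tendsto ξ atTop (𝓝 α) := by
    have hlo : Tendsto (fun k => min (a k) (b k)) atTop (𝓝 (min α α)) := ha.min hb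
    have hhi : Tendsto (fun k => max (a k) (b k)) atTop (𝓝 (max α α)) := ha.max hb
    rw [min_self] at hlo
    rw [max_self] at hhi
    refine tendsto_of_tendsto_of_tendsto_of_le_of_le hlo hhi (fun k => ?_) (fun k => ?_)
    · exact (Set.mem_uIcc.mp (hξmem k)).elim (fun h => le_trans (min_le_left _ _) h.1) (fun h => le_trans (min_le_right _ _) h.1)
    · exact (Set.mem_uIcc.mp (hξmem k)).elim (fun h => le_trans h.2 (le_max_right _ _)) (fun h => le_trans h.2 (le_max_left _ _))
  rw [dslope_pow_mul_exp_same]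
  simp only [hξeq]
  exact tendsto_pow_mul_exp_formula n hξ ht

/-- The same in `iteratedDeriv` currency (the `hconv` shape of W2 #5/#7), for the confluent coefficient function. [folklore] -/
theorem tendsto_iteratedDeriv_dslope_exp (i : ℕ) {a b t : ℕ → ℝ} {α t₀ : ℝ}
    (ha : Tendsto a atTop (𝓝 α)) (hb : Tendsto b atTop (𝓝 α)) (ht : Tendsto t atTop (𝓝 t₀)) :
    Tendsto (fun k => iteratedDeriv i (fun s : ℝ => dslope (fun y : ℝ => Real.exp (y * s)) (a k) (b k)) (t k)) atTop
      (𝓝 (iteratedDeriv i (fun s : ℝ => dslope (fun y : ℝ => Real.exp (y * s)) α α) t₀)) := by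
  simp only [iteratedDeriv_dslope_exp]
  exact tendsto_dslope_pow_mul_exp i ha hb ht

/-- … and for the ordinary coefficient functions `e^{x_k t}`, `x_k → x₀`. [folklore] -/
theorem tendsto_iteratedDeriv_exp (i : ℕ) {x t : ℕ → ℝ} {x₀ t₀ : ℝ}
    (hx : Tendsto x atTop (𝓝 x₀)) (ht : Tendsto t atTop (𝓝 t₀)) :
    Tendsto (fun k => iteratedDeriv i (fun s : ℝ => Real.exp (x k * s)) (t k)) atTop
      (𝓝 (iteratedDeriv i (fun s : ℝ => Real.exp (x₀ * s)) t₀)) := by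
  simp only [iteratedDeriv_exp_const_mul]
  exact (hx.pow i).mul (Real.continuous_exp.continuousAt.tendsto.comp (hx.mul ht))

/-! ## 4. Leibniz bookkeeping for quadratic forms in coefficient functions -/

/-- `iteratedDeriv` of a quadratic form `Σ_pq G_pq c_p c_q` in smooth coefficient functions, by Leibniz. [folklore] -/
theorem iteratedDeriv_quadForm {ι : Type*} [Fintype ι] (G : ι → ι → ℝ) (c : ι → ℝ → ℝ)
    (hc : ∀ p (m : ℕ), ContDiff ℝ m (c p)) (n : ℕ) (t : ℝ) :
    iteratedDeriv n (fun s => ∑ p, ∑ q, G p q * (c p s * c q s)) t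
      = ∑ p, ∑ q, G p q * ∑ i ∈ range (n + 1), ((n.choose i : ℕ) : ℝ) * iteratedDeriv i (c p) t * iteratedDeriv (n - i) (c q) t := by
  have hmul : ∀ p q, ContDiffAt ℝ n (fun s => c p s * c q s) t := fun p q => ((hc p n).mul (hc q n)).contDiffAt
  have hterm : ∀ p q, ContDiffAt ℝ n (fun s => G p q * (c p s * c q s)) t := fun p q => (contDiff_const.contDiffAt).mul (hmul p q)
  have hrow : ∀ p, ContDiffAt ℝ n (fun s => ∑ q, G p q * (c p s * c q s)) t := fun p =>
    (ContDiff.sum fun q _ => contDiff_const.mul ((hc p n).mul (hc q n))).contDiffAt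
  rw [iteratedDeriv_fun_sum (fun p _ => hrow p)]
  refine Finset.sum_congr rfl fun p _ => ?_
  rw [iteratedDeriv_fun_sum (fun q _ => hterm p q)]
  refine Finset.sum_congr rfl fun q _ => ?_
  rw [iteratedDeriv_const_mul _ (hmul p q)]
  congr 1
  have hfg : (fun s => c p s * c q s) = c p * c q := rfl
  rw [hfg, iteratedDeriv_mul (hc p n).contDiffAt (hc q n).contDiffAt]

/-- **Continuous convergence of quadratic forms with all derivatives**: if the matrix entries converge and every coefficient function converges
with all `iteratedDeriv`s along `t_k → t₀`, so does `Σ_pq G_pq c_p c_q`. [folklore] -/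
theorem tendsto_iteratedDeriv_quadForm {ι : Type*} [Fintype ι] (G : ℕ → ι → ι → ℝ) (G₀ : ι → ι → ℝ)
    (c : ℕ → ι → ℝ → ℝ) (c₀ : ι → ℝ → ℝ) (hc : ∀ k p (m : ℕ), ContDiff ℝ m (c k p)) (hc₀ : ∀ p (m : ℕ), ContDiff ℝ m (c₀ p))
    (t : ℕ → ℝ) (t₀ : ℝ) (hG : ∀ p q, Tendsto (fun k => G k p q) atTop (𝓝 (G₀ p q)))
    (hconv : ∀ p i, Tendsto (fun k => iteratedDeriv i (c k p) (t k)) atTop (𝓝 (iteratedDeriv i (c₀ p) t₀))) (n : ℕ) :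
    Tendsto (fun k => iteratedDeriv n (fun s => ∑ p, ∑ q, G k p q * (c k p s * c k q s)) (t k)) atTop
      (𝓝 (iteratedDeriv n (fun s => ∑ p, ∑ q, G₀ p q * (c₀ p s * c₀ q s)) t₀)) := by
  simp only [iteratedDeriv_quadForm _ _ (hc _), iteratedDeriv_quadForm _ _ hc₀]
  refine tendsto_finsetSum _ fun p _ => tendsto_finsetSum _ fun q _ => (hG p q).mul ?_
  refine tendsto_finsetSum _ fun i _ => ?_
  exact (((hconv p i).const_mul _).mul (hconv q (n - i)))

end Summit.ValiantsHypothesis.ValiantsHypothesis.Theorems.LacunarySymmetroidMatrixDescartes.WallBubbling
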